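import HarnessLib
import Summits.Langlands.Langlands.Theses.RepeatedRootSocle
import Literature.NumberTheory.GaloisRepresentations.CyclotomicCharacterFrobeniusProofs
import Literature.NumberTheory.GaloisRepresentations.IntegralGaloisActionProofs
import Literature.NumberTheory.Automorphic.JacquetLanglandsParts

/-!
# Rattack workfile — `RepeatedRootSocle.SectorComplement` (stmt-Langlands-18089) — published as
# `Cruxes/SectorComplement/Rattack_RepeatedRootSocle.lean` (workfile copy, namespace `…Cruxes.SectorComplement.RattackRRS`,
# of the Negative-lane proposal `Theorems/SectorComplement/Negative/RepeatedRootSocleVacuity.lean`):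
# the sector `UnrefinedWeightTwoLifting` is VACUOUS, so the junction IS the summit

Refuter crux-attack (birth vetting, seat `refuter-rattack-stmt-Langlands-18089-0`, 2026-08-17) on
`SectorComplement : Prop := UnrefinedWeightTwoLifting → _root_.Langlands` (route
`route-Langlands-RepeatedRootSocle`, rev 2).  Kernel-checked findings:

* `sympl_invCyclotomic_integralFrobCharpoly_false` — **a framed `ρ : Γ_ℚ → GL₄(ℚ̄_p)` that is
  symplectic with multiplier `ε⁻¹` (the COHOMOLOGICAL convention, `H¹_ét(A)`, Boxer–Calegari–
  Gee–Pilloni) cannot have an INTEGRAL characteristic polynomial of ARITHMETIC Frobenius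
  (`P ∈ ℤ[X]`, the HOMOLOGICAL convention, `V_p(A)`) at a cofinite set of places.**  Proof:
  `ρ(g)ᵀ J ρ(g) = ε(g)⁻¹ J` with `det J ≠ 0` gives `det ρ(g)² = ε(g)⁻⁴`; at an arithmetic
  Frobenius `σ_v` (`v ∤ p`; it exists, `exists_isArithFrobAt_of_mem_primesAbove_holds`, and
  `ε(σ_v) = q_v`, `GaloisRep.cyclotomicCharacter_apply_of_isArithFrobAt`) this reads
  `det ρ(σ_v)² · q_v⁴ = 1`, while `det ρ(σ_v) = P(0) ∈ ℤ`; so `P(0)² q_v⁴ = 1` in `ℤ`, absurd as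
  `q_v ≥ 2`.  (The Weil-root clause of "pure of weight 1" is not even used: integrality alone
  clashes with the multiplier.  With multiplier `ε` — the homological convention of the tree's
  `IsWeightTwoOrdinaryDistinguished`, whose `P`-ordinary shape `(εα, εβ | β⁻¹, α⁻¹)` the route
  inlines — everything is consistent: `det = ε²`, `det ρ(σ_v) = q_v² = P(0)`.)
* `repeatedRootSocle_sympl_pure_false` — the same, with the two hypotheses spelled VERBATIM as the
  route's `Sympl r` and `Pure r` sub-formulas (shared by `UnrefinedWeightTwoLifting`,
  `LimitClassicalUnrefined`, `PadicLimitUnrefined`): the hypothesis set of each of the three typed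
  statements of the route is unsatisfiable, i.e. all three hold EX FALSO (their ex-falso proofs are
  attached as item evidence on stmt-Langlands-18086/18087/18088, not asserted here).
* `sectorComplement_iff_langlands` — consequently **`SectorComplement ↔ Langlands`**: the junction
  item is the whole summit, not a complement of anything; and `not_sectorComplement_iff` —
  `¬ SectorComplement ↔ ¬ Langlands`: no refutation of the item exists short of refuting the
  audited summit (classification: the ITEM survives formally; the ROUTE is misstated).
* Repair handed to the planner (not asserted): use the homological multiplier `ε`
  (`r.IsSymplecticWithMultiplierFun (g ↦ ε g)`, as route `PhantomRM` does) in `Sympl` of all three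
  decls; the derivation of `False` below does not touch that repaired statement.

No statement of the route is asserted positively; `SectorComplement` appears only inside an `↔`
with the summit and under `¬`. [folklore]
-/

set_option linter.dupNamespace false -- project-wide option (lakefile weak.linter.dupNamespace); `Summit.Langlands.Langlands` is the mandated namespace

noncomputable section

open scoped NumberField MatrixGroups Matrix
open IsDedekindDomain Field Filter
open Literature.NumberTheory.GaloisRepresentations
open Summit.Langlands.Langlands.Theses.RepeatedRootSocle

namespace Summit.Langlands.Langlands.Cruxes.SectorComplement.RattackRRS

/-- **Multiplier `ε⁻¹` is inconsistent with an integral arithmetic-Frobenius characteristic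
polynomial in rank `4`.**  If `ρ : Γ_ℚ → GL₄(ℚ̄_p)` satisfies `ρ(g)ᵀ J ρ(g) = ε(g)⁻¹ • J` for an
invertible alternating `J`, and at a cofinite set of finite places every arithmetic Frobenius has
characteristic polynomial `P_v ∈ ℤ[X]`, then `False`: `det ρ(σ_v)² = q_v⁻⁴` against
`det ρ(σ_v) = P_v(0) ∈ ℤ`, at any `v ∤ p` in the cofinite set (there is one: a number field has
infinitely many places and only finitely many divide `p`). [folklore] -/
theorem sympl_invCyclotomic_integralFrobCharpoly_false (p : ℕ) [Fact p.Prime]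
    (ρ : FramedGaloisRep ℚ (PadicAlgCl p) 4)
    (hS : ρ.IsSymplecticWithMultiplierFun (fun g => algebraMap ℚ_[p] (PadicAlgCl p)
      ((((GaloisRep.cyclotomicCharacter ℚ p g)⁻¹ : ℤ_[p]ˣ) : ℤ_[p]) : ℚ_[p])))
    (hP : ∀ᶠ v : HeightOneSpectrum (𝓞 ℚ) in cofinite, ∃ P : Polynomial ℤ,
      ρ.HasFrobCharpolyAt v (P.map (Int.castRingHom (PadicAlgCl p)))) : False := by
  classical
  -- the places above `p` form a finite set
  have hfin : {v : HeightOneSpectrum (𝓞 ℚ) | ((p : ℕ) : 𝓞 ℚ) ∈ v.asIdeal}.Finite := by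
    have hne : (Ideal.span {((p : ℕ) : 𝓞 ℚ)} : Ideal (𝓞 ℚ)) ≠ ⊥ := by
      rw [Ne, Ideal.span_singleton_eq_bot]
      exact_mod_cast (Fact.out : p.Prime).ne_zero
    refine (Ideal.finite_factors hne).subset ?_
    intro v hv
    simp only [Set.mem_setOf_eq] at hv ⊢
    rw [Ideal.dvd_span_singleton]
    exact hv
  have hcof : ∀ᶠ v : HeightOneSpectrum (𝓞 ℚ) in cofinite, ((p : ℕ) : 𝓞 ℚ) ∉ v.asIdeal := by
    rw [Filter.eventually_cofinite]
    simpa using hfin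
  haveI := Literature.NumberTheory.Automorphic.infinite_heightOneSpectrum ℚ
  obtain ⟨v, ⟨P, hPv⟩, hv⟩ := (hP.and hcof).exists
  obtain ⟨𝔓, h𝔓⟩ := v.primesAbove_nonempty
  obtain ⟨σ, hσ⟩ := HeightOneSpectrum.exists_isArithFrobAt_of_mem_primesAbove_holds h𝔓
  have hε : ((GaloisRep.cyclotomicCharacter ℚ p σ : ℤ_[p]ˣ) : ℤ_[p]) = (v.residueCard : ℤ_[p]) :=
    GaloisRep.cyclotomicCharacter_apply_of_isArithFrobAt hv h𝔓 hσ
  have hchar : FramedRep.charpoly ρ σ = P.map (Int.castRingHom (PadicAlgCl p)) :=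
    hPv 𝔓 h𝔓 σ hσ
  set M : Matrix (Fin 4) (Fin 4) (PadicAlgCl p) :=
    ((ρ σ : GL (Fin 4) (PadicAlgCl p)) : Matrix (Fin 4) (Fin 4) (PadicAlgCl p)) with hM
  -- det = constant coefficient of the (integral) characteristic polynomial
  have hdet : M.det = ((P.coeff 0 : ℤ) : PadicAlgCl p) := by
    rw [Matrix.det_eq_sign_charpoly_coeff]
    have hc : M.charpoly = P.map (Int.castRingHom (PadicAlgCl p)) := hchar
    rw [hc, Polynomial.coeff_map, Fintype.card_fin]
    norm_num
  -- the multiplier at `σ`, and `ν(σ) · q_v = 1`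
  set ν : PadicAlgCl p := algebraMap ℚ_[p] (PadicAlgCl p)
      ((((GaloisRep.cyclotomicCharacter ℚ p σ)⁻¹ : ℤ_[p]ˣ) : ℤ_[p]) : ℚ_[p]) with hν
  have hνq : ν * (v.residueCard : PadicAlgCl p) = 1 := by
    have h1 : ((((GaloisRep.cyclotomicCharacter ℚ p σ)⁻¹ : ℤ_[p]ˣ) : ℤ_[p]) : ℚ_[p]) *
        (v.residueCard : ℚ_[p]) = 1 := by
      rw [← PadicInt.coe_natCast, ← hε, ← PadicInt.coe_mul, ← Units.val_mul, inv_mul_cancel,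
        Units.val_one, PadicInt.coe_one]
    have h2 := congrArg (algebraMap ℚ_[p] (PadicAlgCl p)) h1
    rwa [map_mul, map_natCast, map_one] at h2
  -- symplecticity: `det² = ν⁴`
  obtain ⟨J, -, hJunit, hJ⟩ := hS
  have hdet2 : M.det ^ 2 = ν ^ 4 := by
    have h := congrArg Matrix.det (hJ σ)
    rw [Matrix.det_mul, Matrix.det_mul, Matrix.det_transpose, Matrix.det_smul,
      Fintype.card_fin] at h
    have hJ0 : J.det ≠ 0 := hJunit.ne_zero
    have h' : (M.det ^ 2 - ν ^ 4) * J.det = 0 := by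
      rw [sub_mul, sq]
      linear_combination h
    rcases mul_eq_zero.mp h' with h'' | h''
    · exact sub_eq_zero.mp h''
    · exact absurd h'' hJ0
  -- combine: `P(0)² q⁴ = (ν q)⁴ = 1` in `ℚ̄_p`, hence in `ℤ`
  have hZ : (((P.coeff 0) ^ 2 * (v.residueCard : ℤ) ^ 4 : ℤ) : PadicAlgCl p) = 1 := by
    push_cast
    calc ((P.coeff 0 : ℤ) : PadicAlgCl p) ^ 2 * (v.residueCard : PadicAlgCl p) ^ 4
        = M.det ^ 2 * (v.residueCard : PadicAlgCl p) ^ 4 := by rw [hdet]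
      _ = ν ^ 4 * (v.residueCard : PadicAlgCl p) ^ 4 := by rw [hdet2]
      _ = (ν * (v.residueCard : PadicAlgCl p)) ^ 4 := by ring
      _ = 1 := by rw [hνq, one_pow]
  have hZ' : (P.coeff 0) ^ 2 * (v.residueCard : ℤ) ^ 4 = 1 := by
    exact_mod_cast hZ
  have hdvd : ((v.residueCard : ℤ) ^ 4) ∣ 1 := ⟨(P.coeff 0) ^ 2, by linarith⟩
  have hq1 : ((v.residueCard : ℤ) ^ 4) = 1 := Int.eq_one_of_dvd_one (by positivity) hdvd
  have hq : (v.residueCard : ℤ) = 1 := by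
    rcases (pow_eq_one_iff_of_ne_zero (by norm_num : (4 : ℕ) ≠ 0)).mp hq1 with h | h
    · exact h
    · exfalso
      have : (0 : ℤ) ≤ v.residueCard := by positivity
      linarith [h.1]
  have hlt := v.one_lt_residueCard
  omega

/-- **The hypothesis set of the route's three typed statements is unsatisfiable**, with the two
clashing hypotheses spelled verbatim as in `UnrefinedWeightTwoLifting` / `LimitClassicalUnrefined`
/ `PadicLimitUnrefined`: `Sympl r` (symplectic with multiplier `ε⁻¹`) and `Pure r` (a.e.
unramified with INTEGRAL arithmetic-Frobenius characteristic polynomial all of whose complex roots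
have `|z|² = q_v`).  Only `Sympl` and the integrality inside `Pure` are used. [folklore] -/
theorem repeatedRootSocle_sympl_pure_false (p : ℕ) [Fact p.Prime]
    (r : FramedGaloisRep ℚ (PadicAlgCl p) 4)
    (hS : r.IsSymplecticWithMultiplierFun (fun g => algebraMap ℚ_[p] (PadicAlgCl p)
      ((((GaloisRep.cyclotomicCharacter ℚ p g)⁻¹ : ℤ_[p]ˣ) : ℤ_[p]) : ℚ_[p])))
    (hP : ∀ᶠ v : HeightOneSpectrum (𝓞 ℚ) in Filter.cofinite, r.IsUnramifiedAt v ∧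
      ∃ P : Polynomial ℤ, r.HasFrobCharpolyAt v (P.map (Int.castRingHom (PadicAlgCl p))) ∧
        ∀ z : ℂ, (P.map (Int.castRingHom ℂ)).IsRoot z → ‖z‖ ^ 2 = (v.residueCard : ℝ)) :
    False :=
  sympl_invCyclotomic_integralFrobCharpoly_false p r hS (hP.mono fun _ ⟨_, P, hP, _⟩ => ⟨P, hP⟩)

/-- **The junction is the summit**: since the sector statement `UnrefinedWeightTwoLifting` holds
ex falso (its hypotheses `Sympl ρ₀`, `Pure ρ₀` are jointly unsatisfiable,
`repeatedRootSocle_sympl_pure_false`), `SectorComplement := UnrefinedWeightTwoLifting → Langlands`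
is EQUIVALENT to `Langlands`.  (The ex-falso proof of the target is a local `have`, not a
declaration: nothing of the route is asserted here.) [folklore] -/
theorem sectorComplement_iff_langlands : SectorComplement ↔ _root_.Langlands := by
  have hX : UnrefinedWeightTwoLifting := by
    intro p _ _ k _ _ _ _ _ red hcpt ι
    dsimp only
    intro ρ₀ _ _ hS₀ _ hP₀
    exact (repeatedRootSocle_sympl_pure_false p ρ₀ hS₀ hP₀).elim
  exact ⟨fun hC => hC hX, fun hL _ => hL⟩

/-- … hence **`¬ SectorComplement ↔ ¬ Langlands`**: the item admits no refutation short of a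
refutation of the audited summit (so none is claimed), and no proof short of the summit.
[folklore] -/
theorem not_sectorComplement_iff : ¬ SectorComplement ↔ ¬ _root_.Langlands :=
  not_congr sectorComplement_iff_langlands

/-- Probe `S → C` (trivial for a junction) and probe `C → S` (here ALSO provable — the
restates-summit probe succeeds because the sector is vacuous): recorded as the two directions.
[folklore] -/
theorem sectorComplement_restates_summit :
    (_root_.Langlands → SectorComplement) ∧ (SectorComplement → _root_.Langlands) :=
  ⟨sectorComplement_iff_langlands.mpr, sectorComplement_iff_langlands.mp⟩

end Summit.Langlands.Langlands.Cruxes.SectorComplement.RattackRRS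

end
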